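import Summits.HodgeConjecture.CorCM.AbelianTwoGroupThinCriterion
import HarnessLib

/-!
# The ATOM-EMBEDDING theorem for abelian `2`-groups with a marked involution

COR-CM (cell `pub-hodgecm2`), binder seat b04 (gen 16), count-neutral claim ABELIAN-2POWER-NECESSITY, part IIIb.
KERNEL ONLY: theorems (pure group theory, Mathlib only); no definition, no named fact, no `sorry`.

For a finite abelian group `A` of order `2^{n+1}` (written additively) with a marked involution `c ≠ 0`, exactly one
of the following "good" alternatives holds, or `A` contains one of six ATOMS through `c`:

* (α) THIN: `c ∈ ℤ z` for some `z` with `|A| ≤ 2·ord z` (a cyclic subgroup of index `≤ 2` through `c`);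
* (β) `|A| ≤ 8`;
* (γ) `|A| = 16` and every double `2g` is `0` or `c`;
* (atoms) an injective homomorphism `j : M ↪ A` with `j(c₀) = c` for `(M, c₀)` one of
  `(ℤ/4 × ℤ/4, (2,0))`, `(ℤ/4 × ℤ/2 × ℤ/2, (0,1,0))`, `(ℤ/8 × ℤ/2, (0,1))`, `((ℤ/2)⁵, (0,0,0,0,1))`,
  `((ℤ/2)³ × ℤ/4, (0,0,0,2))`, `((ℤ/2)² × ℤ/8, (0,0,4))`.

* §1 `exists_coprod_two_of_card_lt` — the greedy step: an injective `j : M ↪ A` from a group with fewer involutions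
  than `A` extends by an involution of `A` outside `im j`.
* §2 the six embeddings from intrinsic data (`embed_44`, `embed_422`, `embed_82`, `embed_22222`, `embed_2224`,
  `embed_228`).
* §3 **`atom_cases`** — the case analysis (square/non-square `c`; elements of order `4`, `8`; the number of
  involutions `|A[2]| ∈ {≤ 4, 8, ≥ 16}`), using part IIIa (pieces, descent, counting) and IIIa′ (the thin case).

Applied in part IV to `A = Additive Gal(K/ℚ)`, `c =` complex conjugation, for abelian CM fields `K` of `2`-power
degree; the atoms carry the kernel-decided subgroup models of part II.

## References

* [Dodson1984] B. Dodson, *The structure of Galois groups of CM-fields*, Trans. AMS 283 (1984), §3.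
-/

namespace Summit.HodgeConjecture.CorCM.TwoGroupPieces

open scoped Classical

variable {A : Type*} [AddCommGroup A]

/-! ## §1 The greedy step -/

/-- **Greedy step.**  If `j : M ↪ A` is injective and `M` has fewer solutions of `2x = 0` than `A`, some involution
`t` of `A` lies outside `im j`, and `l_t ⊕ j : ℤ/2 × M ↪ A` is injective. [folklore] -/
theorem exists_coprod_two_of_card_lt [Fintype A] [DecidableEq A] {M : Type*} [AddCommGroup M] [Fintype M]
    [DecidableEq M] (j : M →+ A) (hj : Function.Injective j)
    (hM : (Finset.univ.filter fun m : M => 2 • m = 0).card < (Finset.univ.filter fun x : A => 2 • x = 0).card) :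
    ∃ l : ZMod 2 →+ A, Function.Injective (l.coprod j) ∧ ∀ m : M, l.coprod j (0, m) = j m := by
  obtain ⟨t, ht, htj⟩ : ∃ t : A, 2 • t = 0 ∧ t ∉ j.range := by
    by_contra hall
    push Not at hall
    have hsub : (Finset.univ.filter fun x : A => 2 • x = 0) ⊆
        (Finset.univ.filter fun m : M => 2 • m = 0).image j := by
      intro x hx
      simp only [Finset.mem_filter, Finset.mem_univ, true_and] at hx
      obtain ⟨m, rfl⟩ := hall x hx
      refine Finset.mem_image.2 ⟨m, ?_, rfl⟩
      simp only [Finset.mem_filter, Finset.mem_univ, true_and]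
      apply hj
      rw [map_nsmul, hx, map_zero]
    exact absurd ((Finset.card_le_card hsub).trans Finset.card_image_le) (not_le.2 hM)
  obtain ⟨l, hl⟩ := exists_zmodHom 2 t ht
  exact ⟨l, coprod_injective_two l hl j hj htj, fun m => by
    simp only [AddMonoidHom.coprod_apply, map_zero, zero_add]⟩

/-! ## §2 The six embeddings -/

/-- Atom `ℤ/4 × ℤ/4` through `c = (2,0)`: from `u` with `2u = c` and `v` with `4v = 0`, `2v ∉ {0, c}`. [folklore] -/
theorem embed_44 (c u v : A) (hc0 : c ≠ 0) (hc2 : 2 • c = 0) (hu : 2 • u = c) (hv4 : 4 • v = 0)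
    (hv2 : 2 • v ≠ 0) (hvc : 2 • v ≠ c) :
    ∃ j : ZMod 4 × ZMod 4 →+ A, Function.Injective j ∧ j (2, 0) = c := by
  have hu4 : 4 • u = 0 := by rw [show (4 : ℕ) = 2 * 2 from rfl, mul_nsmul', hu, hc2]
  obtain ⟨lu, hlu⟩ := exists_zmodHom 4 u hu4
  obtain ⟨lv, hlv⟩ := exists_zmodHom 4 v hv4
  refine ⟨lu.coprod lv, coprod_injective_four lu hlu hu4 lv (injective_four lv hlv hv4 hv2) ?_, ?_⟩
  · intro h
    rw [hu] at h
    rcases eq_of_mem_range_four lv hlv hv4 hv2 h hc2 with h0 | h1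
    · exact hc0 h0
    · exact hvc h1.symm
  · simp only [AddMonoidHom.coprod_apply, map_zero, add_zero, hlu]
    exact hu

/-- Atom `ℤ/4 × ℤ/2 × ℤ/2` through `c = (0,1,0)`: from `v` with `4v = 0`, `2v ∉ {0, c}` when `A` has at least `8`
involutions (an involution outside the `4` involutions of `im(l_v ⊕ l_c)` exists). [folklore] -/
theorem embed_422 [Fintype A] [DecidableEq A] (c v : A) (hc0 : c ≠ 0) (hc2 : 2 • c = 0) (hv4 : 4 • v = 0)
    (hv2 : 2 • v ≠ 0) (hvc : 2 • v ≠ c) (hI : 8 ≤ (Finset.univ.filter fun x : A => 2 • x = 0).card) :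
    ∃ j : ZMod 4 × ZMod 2 × ZMod 2 →+ A, Function.Injective j ∧ j (0, 1, 0) = c := by
  obtain ⟨lc, hlc⟩ := exists_zmodHom 2 c hc2
  obtain ⟨lv, hlv⟩ := exists_zmodHom 4 v hv4
  have h₂ : Function.Injective (lv.coprod lc) := by
    refine coprod_injective_four lv hlv hv4 lc (injective_two lc hlc hc0) ?_
    rw [mem_range_two lc hlc]; push Not; exact ⟨hv2, hvc⟩
  have hcount : (Finset.univ.filter fun m : ZMod 4 × ZMod 2 => 2 • m = 0).card = 4 := by decide
  obtain ⟨ly, h₃, h₃c⟩ := exists_coprod_two_of_card_lt (lv.coprod lc) h₂ (by omega)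
  -- reorder the coordinates `(y, v, c) ↦ (v, c, y)`
  let σ : ZMod 4 × ZMod 2 × ZMod 2 →+ ZMod 2 × ZMod 4 × ZMod 2 :=
    ((AddMonoidHom.snd _ _).comp (AddMonoidHom.snd _ _)).prod
      ((AddMonoidHom.fst _ _).prod ((AddMonoidHom.fst _ _).comp (AddMonoidHom.snd _ _)))
  have hσ : Function.Injective σ := by decide
  refine ⟨(ly.coprod (lv.coprod lc)).comp σ, h₃.comp hσ, ?_⟩
  rw [AddMonoidHom.comp_apply, show σ (0, 1, 0) = (0, 0, 1) from rfl, h₃c]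
  simp only [AddMonoidHom.coprod_apply, map_zero, zero_add, hlc]
  exact one_smul ℕ c

/-- Atom `ℤ/8 × ℤ/2` through `c = (0,1)`: from `w` with `8w = 0`, `4w ∉ {0, c}`. [folklore] -/
theorem embed_82 (c w : A) (hc0 : c ≠ 0) (hc2 : 2 • c = 0) (hw8 : 8 • w = 0) (hw4 : 4 • w ≠ 0)
    (hwc : 4 • w ≠ c) : ∃ j : ZMod 8 × ZMod 2 →+ A, Function.Injective j ∧ j (0, 1) = c := by
  obtain ⟨lc, hlc⟩ := exists_zmodHom 2 c hc2
  obtain ⟨lw, hlw⟩ := exists_zmodHom 8 w hw8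
  refine ⟨lw.coprod lc, coprod_injective_eight lw hlw hw8 lc (injective_two lc hlc hc0) ?_, ?_⟩
  · rw [mem_range_two lc hlc]; push Not; exact ⟨hw4, hwc⟩
  · simp only [AddMonoidHom.coprod_apply, map_zero, zero_add, hlc]
    exact one_smul ℕ c

/-- Atom `(ℤ/2)⁵` through `c = (0,0,0,0,1)`: `A` of exponent `2` and order `≥ 32` (four greedy steps).
[folklore] -/
theorem embed_22222 [Fintype A] [DecidableEq A] (c : A) (hc0 : c ≠ 0) (h2 : ∀ x : A, 2 • x = 0)
    (h32 : 32 ≤ Fintype.card A) :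
    ∃ j : ZMod 2 × ZMod 2 × ZMod 2 × ZMod 2 × ZMod 2 →+ A, Function.Injective j ∧ j (0, 0, 0, 0, 1) = c := by
  have hpool : (Finset.univ.filter fun x : A => 2 • x = 0).card = Fintype.card A := by
    rw [Finset.filter_true_of_mem fun x _ => h2 x, Finset.card_univ]
  obtain ⟨l₁, hl₁⟩ := exists_zmodHom 2 c (h2 c)
  have h₁ : Function.Injective l₁ := injective_two l₁ hl₁ hc0
  have hc₁ : l₁ 1 = c := by rw [hl₁]; exact one_smul ℕ c
  have e₁ : (Finset.univ.filter fun m : ZMod 2 => 2 • m = 0).card = 2 := by decide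
  obtain ⟨l₂, h₂, hc₂⟩ := exists_coprod_two_of_card_lt l₁ h₁ (by omega)
  have e₂ : (Finset.univ.filter fun m : ZMod 2 × ZMod 2 => 2 • m = 0).card = 4 := by decide
  obtain ⟨l₃, h₃, hc₃⟩ := exists_coprod_two_of_card_lt _ h₂ (by omega)
  have e₃ : (Finset.univ.filter fun m : ZMod 2 × ZMod 2 × ZMod 2 => 2 • m = 0).card = 8 := by decide
  obtain ⟨l₄, h₄, hc₄⟩ := exists_coprod_two_of_card_lt _ h₃ (by omega)
  have e₄ : (Finset.univ.filter fun m : ZMod 2 × ZMod 2 × ZMod 2 × ZMod 2 => 2 • m = 0).card = 16 := by decide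
  obtain ⟨l₅, h₅, hc₅⟩ := exists_coprod_two_of_card_lt _ h₄ (by omega)
  exact ⟨_, h₅, by rw [hc₅, hc₄, hc₃, hc₂, hc₁]⟩

/-- Atom `(ℤ/2)³ × ℤ/4` through `c = (0,0,0,2)`: from `u` with `2u = c` when `A` has at least `16` involutions
(three greedy steps over the order-`4` piece `l_u`). [folklore] -/
theorem embed_2224 [Fintype A] [DecidableEq A] (c u : A) (hc0 : c ≠ 0) (hc2 : 2 • c = 0) (hu : 2 • u = c)
    (hI : 16 ≤ (Finset.univ.filter fun x : A => 2 • x = 0).card) :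
    ∃ j : ZMod 2 × ZMod 2 × ZMod 2 × ZMod 4 →+ A, Function.Injective j ∧ j (0, 0, 0, 2) = c := by
  have hu4 : 4 • u = 0 := by rw [show (4 : ℕ) = 2 * 2 from rfl, mul_nsmul', hu, hc2]
  have hu2 : 2 • u ≠ 0 := by rw [hu]; exact hc0
  obtain ⟨l₁, hl₁⟩ := exists_zmodHom 4 u hu4
  have h₁ : Function.Injective l₁ := injective_four l₁ hl₁ hu4 hu2
  have hc₁ : l₁ 2 = c := by rw [hl₁, ← hu]; rfl
  have e₁ : (Finset.univ.filter fun m : ZMod 4 => 2 • m = 0).card = 2 := by decide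
  obtain ⟨l₂, h₂, hc₂⟩ := exists_coprod_two_of_card_lt l₁ h₁ (by omega)
  have e₂ : (Finset.univ.filter fun m : ZMod 2 × ZMod 4 => 2 • m = 0).card = 4 := by decide
  obtain ⟨l₃, h₃, hc₃⟩ := exists_coprod_two_of_card_lt _ h₂ (by omega)
  have e₃ : (Finset.univ.filter fun m : ZMod 2 × ZMod 2 × ZMod 4 => 2 • m = 0).card = 8 := by decide
  obtain ⟨l₄, h₄, hc₄⟩ := exists_coprod_two_of_card_lt _ h₃ (by omega)
  exact ⟨_, h₄, by rw [hc₄, hc₃, hc₂, hc₁]⟩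

/-- Atom `(ℤ/2)² × ℤ/8` through `c = (0,0,4)`: from `w` with `8w = 0`, `4w = c` when `A` has at least `8`
involutions (two greedy steps over the order-`8` piece `l_w`). [folklore] -/
theorem embed_228 [Fintype A] [DecidableEq A] (c w : A) (hc0 : c ≠ 0) (hw8 : 8 • w = 0) (hw : 4 • w = c)
    (hI : 8 ≤ (Finset.univ.filter fun x : A => 2 • x = 0).card) :
    ∃ j : ZMod 2 × ZMod 2 × ZMod 8 →+ A, Function.Injective j ∧ j (0, 0, 4) = c := by
  have hw4 : 4 • w ≠ 0 := by rw [hw]; exact hc0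
  obtain ⟨l₁, hl₁⟩ := exists_zmodHom 8 w hw8
  have h₁ : Function.Injective l₁ := injective_eight l₁ hl₁ hw8 hw4
  have hc₁ : l₁ 4 = c := by rw [hl₁, ← hw]; rfl
  have e₁ : (Finset.univ.filter fun m : ZMod 8 => 2 • m = 0).card = 2 := by decide
  obtain ⟨l₂, h₂, hc₂⟩ := exists_coprod_two_of_card_lt l₁ h₁ (by omega)
  have e₂ : (Finset.univ.filter fun m : ZMod 2 × ZMod 8 => 2 • m = 0).card = 4 := by decide
  obtain ⟨l₃, h₃, hc₃⟩ := exists_coprod_two_of_card_lt _ h₂ (by omega)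
  exact ⟨_, h₃, by rw [hc₃, hc₂, hc₁]⟩


/-! ## §3 The case analysis -/

/-- **ATOM-EMBEDDING THEOREM.**  Let `A` be a finite abelian group of order `2^{n+1}` and `c ∈ A` an involution.
Then either (α) `c ∈ ℤ z` with `|A| ≤ 2·ord z` (thin), or (β) `|A| ≤ 8`, or (γ) `|A| = 16` with every double in
`{0, c}`, or one of the six atoms `(ℤ/4 × ℤ/4, (2,0))`, `(ℤ/4 × ℤ/2 × ℤ/2, (0,1,0))`, `(ℤ/8 × ℤ/2, (0,1))`,
`((ℤ/2)⁵, e₅)`, `((ℤ/2)³ × ℤ/4, (0,0,0,2))`, `((ℤ/2)² × ℤ/8, (0,0,4))` embeds into `A` through `c`.  Proof: split on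
whether `c` is a double, on the existence of elements of order `4` and `8`, and on the number of involutions
`|A[2]| ∈ {≤ 4, 8, ≥ 16}`; the thin case is part IIIa′, exponent bounds come from descent, order bounds from
`|A| ≤ |A[2]|·|2A|`. [folklore] -/
theorem atom_cases [Fintype A] [DecidableEq A] {n : ℕ} (hA : Fintype.card A = 2 ^ (n + 1)) (c : A)
    (hc0 : c ≠ 0) (hc2 : 2 • c = 0) :
    (∃ z : A, (∃ k : ℤ, k • z = c) ∧ Fintype.card A ≤ 2 * addOrderOf z) ∨
    Fintype.card A ≤ 8 ∨
    (Fintype.card A = 16 ∧ ∀ g : A, 2 • g = 0 ∨ 2 • g = c) ∨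
    (∃ j : ZMod 4 × ZMod 4 →+ A, Function.Injective j ∧ j (2, 0) = c) ∨
    (∃ j : ZMod 4 × ZMod 2 × ZMod 2 →+ A, Function.Injective j ∧ j (0, 1, 0) = c) ∨
    (∃ j : ZMod 8 × ZMod 2 →+ A, Function.Injective j ∧ j (0, 1) = c) ∨
    (∃ j : ZMod 2 × ZMod 2 × ZMod 2 × ZMod 2 × ZMod 2 →+ A, Function.Injective j ∧ j (0, 0, 0, 0, 1) = c) ∨
    (∃ j : ZMod 2 × ZMod 2 × ZMod 2 × ZMod 4 →+ A, Function.Injective j ∧ j (0, 0, 0, 2) = c) ∨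
    (∃ j : ZMod 2 × ZMod 2 × ZMod 8 →+ A, Function.Injective j ∧ j (0, 0, 4) = c) := by
  obtain ⟨i, -, hIi⟩ := card_filter_two_nsmul_eq_pow hA
  have hall : ∀ x : A, 2 ^ (n + 1) • x = 0 := fun x => by rw [← hA]; exact card_nsmul_eq_zero
  have htri := two_pow_trichotomy i
  -- exponent bounds by descent
  have hexp4 : (∀ w : A, 8 • w = 0 → 4 • w = 0) → ∀ x : A, 4 • x = 0 := fun h8 x => by
    have h := nsmul_eq_zero_of_descent (n + 1) 2 hall (fun y hy => h8 y hy) x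
    exact h
  have hexp2 : (∀ v : A, 4 • v = 0 → 2 • v = 0) → ∀ x : A, 2 • x = 0 := fun h4 x => by
    have h := nsmul_eq_zero_of_descent (n + 1) 1 hall (fun y hy => h4 y hy) x
    exact h
  -- order bounds from `|A| ≤ |A[2]| · |2A|`
  have hcount := card_le_card_filter_mul_card_image (A := A)
  rw [hIi] at hcount
  -- `2^(n+1) ≤ 16` means `≤ 8` or `= 16`
  have hsmall : Fintype.card A ≤ 16 → Fintype.card A ≤ 8 ∨ Fintype.card A = 16 := fun h => by
    rcases two_pow_trichotomy (n + 1) with h' | h' | h' <;> omega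
  by_cases hsq : ∃ u : A, 2 • u = c
  · -- `c` is a double
    obtain ⟨u, hu⟩ := hsq
    by_cases hv : ∃ v : A, 4 • v = 0 ∧ 2 • v ≠ 0 ∧ 2 • v ≠ c
    · -- atom `ℤ/4 × ℤ/4`
      obtain ⟨v, hv4, hv2, hvc⟩ := hv
      exact Or.inr <| Or.inr <| Or.inr <| Or.inl (embed_44 c u v hc0 hc2 hu hv4 hv2 hvc)
    · push Not at hv
      have hW : ∀ v : A, 4 • v = 0 → 2 • v = 0 ∨ 2 • v = c := fun v h4 => by
        by_cases h : 2 • v = 0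
        · exact Or.inl h
        · exact Or.inr (hv v h4 h)
      rcases htri with hI4 | hI8
      · -- thin
        exact Or.inl (exists_generator_of_thin hA c hc0 ⟨u, hu⟩ hW (by rw [hIi]; exact hI4))
      · have hge8 : 8 ≤ (Finset.univ.filter fun x : A => 2 • x = 0).card := by
          rw [hIi]; rcases hI8 with h | h <;> omega
        by_cases h8 : ∃ w : A, 8 • w = 0 ∧ 4 • w ≠ 0
        · -- atom `(ℤ/2)² × ℤ/8`
          obtain ⟨w, hw8, hw4⟩ := h8
          have hwc : 4 • w = c := by
            have h := hv (2 • w) (by rw [← mul_nsmul', show (4 * 2 : ℕ) = 8 from rfl]; exact hw8)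
              (by rw [← mul_nsmul', show (2 * 2 : ℕ) = 4 from rfl]; exact hw4)
            rwa [← mul_nsmul', show (2 * 2 : ℕ) = 4 from rfl] at h
          exact Or.inr <| Or.inr <| Or.inr <| Or.inr <| Or.inr <| Or.inr <| Or.inr <| Or.inr
            (embed_228 c w hc0 hw8 hwc hge8)
        · push Not at h8
          have hγ : ∀ g : A, 2 • g = 0 ∨ 2 • g = c := fun g => hW g (hexp4 h8 g)
          rcases hI8 with hI8 | hI16
          · -- `|A[2]| = 8`, `|2A| ≤ 2`: `|A| ≤ 16`
            have himg : (Finset.univ.image fun x : A => 2 • x).card ≤ 2 := by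
              refine le_trans (Finset.card_le_card fun y hy => ?_) (Finset.card_le_two (a := (0 : A)) (b := c))
              obtain ⟨x, -, rfl⟩ := Finset.mem_image.1 hy
              simp only [Finset.mem_insert, Finset.mem_singleton]
              exact hγ x
            have h16 : Fintype.card A ≤ 16 :=
              hcount.trans (by rw [hI8]; exact (Nat.mul_le_mul_left 8 himg).trans (by omega))
            rcases hsmall h16 with h | h
            · exact Or.inr <| Or.inl h
            · exact Or.inr <| Or.inr <| Or.inl ⟨h, hγ⟩
          · -- atom `(ℤ/2)³ × ℤ/4`
            exact Or.inr <| Or.inr <| Or.inr <| Or.inr <| Or.inr <| Or.inr <| Or.inr <| Or.inl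
              (embed_2224 c u hc0 hc2 hu (by rw [hIi]; exact hI16))
  · -- `c` is not a double
    push Not at hsq
    by_cases h4 : ∃ v : A, 4 • v = 0 ∧ 2 • v ≠ 0
    · obtain ⟨v, hv4, hv2⟩ := h4
      have hvc : 2 • v ≠ c := hsq v
      rcases htri with hI4 | hI8
      · by_cases h8 : ∃ w : A, 8 • w = 0 ∧ 4 • w ≠ 0
        · -- atom `ℤ/8 × ℤ/2`
          obtain ⟨w, hw8, hw4⟩ := h8
          have hwc : 4 • w ≠ c := by
            rw [show (4 : ℕ) = 2 * 2 from rfl, mul_nsmul']; exact hsq _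
          exact Or.inr <| Or.inr <| Or.inr <| Or.inr <| Or.inr <| Or.inl (embed_82 c w hc0 hc2 hw8 hw4 hwc)
        · -- exponent `4`, `2A ⊆ A[2] ∖ {c, 2v + c}`: `|A| ≤ 4 · 2`
          push Not at h8
          have he4 := hexp4 h8
          set Inv := Finset.univ.filter fun x : A => 2 • x = 0 with hInv
          have hcI : c ∈ Inv := by simp only [hInv, Finset.mem_filter, Finset.mem_univ, true_and]; exact hc2
          have hvcI : 2 • v + c ∈ Inv.erase c := by
            refine Finset.mem_erase.2 ⟨fun h => hv2 ?_, ?_⟩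
            · simpa using h
            · simp only [hInv, Finset.mem_filter, Finset.mem_univ, true_and, smul_add, hc2, add_zero]
              rw [← mul_nsmul', show (2 * 2 : ℕ) = 4 from rfl, hv4]
          have himg : (Finset.univ.image fun x : A => 2 • x).card ≤ 2 := by
            have hsub : (Finset.univ.image fun x : A => 2 • x) ⊆ (Inv.erase c).erase (2 • v + c) := by
              intro y hy
              obtain ⟨x, -, rfl⟩ := Finset.mem_image.1 hy
              refine Finset.mem_erase.2 ⟨fun h => hsq (x - v) ?_, Finset.mem_erase.2 ⟨hsq x, ?_⟩⟩
              · rw [smul_sub, h, add_sub_cancel_left]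
              · simp only [hInv, Finset.mem_filter, Finset.mem_univ, true_and]
                rw [← mul_nsmul', show (2 * 2 : ℕ) = 4 from rfl, he4]
            refine (Finset.card_le_card hsub).trans ?_
            rw [Finset.card_erase_of_mem hvcI, Finset.card_erase_of_mem hcI, hIi]
            omega
          exact Or.inr <| Or.inl (hcount.trans ((Nat.mul_le_mul hI4 himg).trans (by omega)))
      · -- atom `ℤ/4 × ℤ/2 × ℤ/2`
        have hge8 : 8 ≤ (Finset.univ.filter fun x : A => 2 • x = 0).card := by
          rw [hIi]; rcases hI8 with h | h <;> omega
        exact Or.inr <| Or.inr <| Or.inr <| Or.inr <| Or.inl (embed_422 c v hc0 hc2 hv4 hv2 hvc hge8)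
    · -- exponent `2`
      push Not at h4
      have he2 := hexp2 h4
      by_cases h32 : 32 ≤ Fintype.card A
      · -- atom `(ℤ/2)⁵`
        exact Or.inr <| Or.inr <| Or.inr <| Or.inr <| Or.inr <| Or.inr <| Or.inl (embed_22222 c hc0 he2 h32)
      · have h16 : Fintype.card A ≤ 16 := by
          have hlt : 2 ^ (n + 1) < 2 ^ 5 := by rw [← hA]; omega
          have hn : n + 1 ≤ 4 := by
            have := (Nat.pow_lt_pow_iff_right (by omega : 1 < 2)).1 hlt
            omega
          rw [hA]
          calc 2 ^ (n + 1) ≤ 2 ^ 4 := Nat.pow_le_pow_right (by omega) hn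
            _ = 16 := by decide
        rcases hsmall h16 with h | h
        · exact Or.inr <| Or.inl h
        · exact Or.inr <| Or.inr <| Or.inl ⟨h, fun g => Or.inl (he2 g)⟩

end Summit.HodgeConjecture.CorCM.TwoGroupPieces
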